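import Mathlib
import HarnessLib

/-!
# Venture HSemireg — THEOREM M off the flat locus: the moment identity for LEVEL-UNIFORM margins (W5 seat w5-n6-2 gen 19)

Bookkeeping of the computation cell `pub-hsemireg`, group W5 (notes `widen/W5/SLIVER-w5n62g18.md` §7 (2)
«for level-uniform margins μ the pendant rule becomes a weighted sum and an analogue exists (not derived
here)», `widen/W5/FLATTF-w5n62g17.md` §0 ∕ §9 (LEMMA U: level-uniform margins); this leg
`widen/W5/KERNEL-M-w5n62g19.md` §7, deposit `widen/W5/n6code2/v22/margins/`). Companion of
`FlatMomentIdentity.lean` (the flat case `μ ≡ d`, all `t_X = t`), same seat and method; PLAIN, no helper of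
the tree restated (the Fubini steps are local `have`s).

SETTING (N7-FEASIBILITY §3.6 (a), FLATTF §0). Four finite level types `A, B, C, D` with `t_A, t_B, t_C,
t_D` levels, margin functions `μ_A : A → R, …, μ_D : D → R` over a commutative ring `R`, and six torus
matrices `xAB, …, xCD` such that level `ξ` of `X` has line sum `μ_X(ξ)` in EACH of the three matrices through
`X` (LEVEL-UNIFORM margins: `Σ_b xAB a b = μ_A a`, `Σ_a xAB a b = μ_B b`, …), with `Σ_ξ μ_X(ξ) = m` for
`X = A, B, C` (for `D` it follows). With `0 ∕ 1` entries this is a four-coordinate design with level-uniform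
margins; the transversal sums `K₄, P, Q, ΣpM, T_XYZ` are as in `FlatMomentIdentity`, and the new moments are
`p_X = Σ_ξ μ_X(ξ)²`, `C_X = Σ_ξ μ_X(ξ)³` (N7F §3.8 (a)) and the twelve WEIGHTED triangle counts
`Σ_{triangle} μ_V(v)` (one per triangle `XYZ` and vertex `V`; their sum over `V` is the paw count `Paw_XYZ`).

* `marginMomentM` — **THEOREM M⁺**, stated as ONE sum over transversals of the exact-class combination
  `18·[K₄] + [P] + 4·[Q] − 2·[ΣpM]` (splitting it into the four class sums is `Finset.sum_add_distrib`;
  the flat file states the split form):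
  `18·K₄ + P + 4·Q − 2·ΣpM = Σ_X (Σ_{W ≠ X} t_W)·p_X − 6 m² − 3 Σ_{XYZ} t_W·T_XYZ − 3 Σ_X C_X + 3 ΣPaw`
  (`W` the coordinate outside the triangle `XYZ`). At `μ ≡ d`, `t_X = t`: `p_X = t d²`, `C_X = t d³`,
  `Paw_XYZ = 3 d T_XYZ`, and the right side is `6 d² t (t − 2d) + 3 (3d − t) T_tot` = THEOREM M.
  Proof: the pointwise expansion of `FlatMomentIdentity.momentM_monomials` (re-proved inline by `ring`
  as a local `have`, nothing imported or restated at tree level), one sum over transversals, Fubini so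
  that every monomial is summed LEAVES FIRST (a coordinate met by one torus is summed out by a line sum
  `μ`; the centre of a 2-path or star goes last, giving `p_X` ∕ `C_X`), one `simp` with the line sums.

HONEST FRAMING: finite sums and ring arithmetic only; an identity valid for every such family of matrices.
Consequences for the non-flat sector of the family-S door need the `|S| ≤ 4` class equations for
level-uniform margins (N7F §3.8 (a): `ΣN(C₄) = 2ΣB + ΣC − 2m² − m s² − ΣPaw + ΣF₅ − N(K₄)` etc.), which are
NOT formalized here. Nothing in this file says that HC, HC_CM or HC_AV holds; no door ∕ tier ∕ report
sentence of the cell is a consequence of this file alone.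
-/

namespace Summit.Ventures.HSemireg
namespace UniformMarginMomentIdentity
open Finset

variable {R : Type*} [CommRing R]
variable {A B C D : Type*} [Fintype A] [Fintype B] [Fintype C] [Fintype D]

/-- **THEOREM M⁺** (THEOREM M of SLIVER-w5n62g18 §0 for level-uniform margins). Data: level counts
`tA … tD`, margin functions `μA … μD` with totals `m` on `A, B, C`, six matrices whose line sums through a
level are that level's margin (`rXY` rows, `cXY` columns). Conclusion: summed over the transversals
`(a,b,c,e)`, the exact-class combination `18·[K₄] + [P] + 4·[Q] − 2·[ΣpM]` (indicator polynomials as in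
`FlatMomentIdentity.momentM`, kept here as one sum) equals
`Σ_X (Σ_{W≠X} t_W)·p_X − 6m² − 3 Σ t_W·T_XYZ − 3 ΣC_X + 3 ΣPaw`, the paw term written as the twelve
weighted triangle sums in the shape the summation leaves them. -/
theorem marginMomentM (tA tB tC tD m : R) (μA : A → R) (μB : B → R) (μC : C → R) (μD : D → R)
    (xAB : A → B → R) (xAC : A → C → R) (xAD : A → D → R)
    (xBC : B → C → R) (xBD : B → D → R) (xCD : C → D → R)
    (hA : (Fintype.card A : R) = tA) (hB : (Fintype.card B : R) = tB)
    (hC : (Fintype.card C : R) = tC) (hD : (Fintype.card D : R) = tD)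
    (hmA : ∑ a, μA a = m) (hmB : ∑ b, μB b = m) (hmC : ∑ c, μC c = m)
    (rAB : ∀ a, ∑ b, xAB a b = μA a) (cAB : ∀ b, ∑ a, xAB a b = μB b)
    (rAC : ∀ a, ∑ c, xAC a c = μA a) (cAC : ∀ c, ∑ a, xAC a c = μC c)
    (rAD : ∀ a, ∑ e, xAD a e = μA a) (cAD : ∀ e, ∑ a, xAD a e = μD e)
    (rBC : ∀ b, ∑ c, xBC b c = μB b) (cBC : ∀ c, ∑ b, xBC b c = μC c)
    (rBD : ∀ b, ∑ e, xBD b e = μB b) (cBD : ∀ e, ∑ b, xBD b e = μD e)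
    (rCD : ∀ c, ∑ e, xCD c e = μC c) (cCD : ∀ e, ∑ c, xCD c e = μD e) :
    ∑ a, ∑ b, ∑ c, ∑ e,
      (18 * (xAB a b * xAC a c * xAD a e * xBC b c * xBD b e * xCD c e)
      + (xAB a b * xAC a c * (1 - xAD a e) * (1 - xBC b c) * (1 - xBD b e) * (1 - xCD c e)
          + xAB a b * xAD a e * (1 - xAC a c) * (1 - xBC b c) * (1 - xBD b e) * (1 - xCD c e)
          + xAB a b * xBC b c * (1 - xAC a c) * (1 - xAD a e) * (1 - xBD b e) * (1 - xCD c e)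
          + xAB a b * xBD b e * (1 - xAC a c) * (1 - xAD a e) * (1 - xBC b c) * (1 - xCD c e)
          + xAC a c * xAD a e * (1 - xAB a b) * (1 - xBC b c) * (1 - xBD b e) * (1 - xCD c e)
          + xAC a c * xBC b c * (1 - xAB a b) * (1 - xAD a e) * (1 - xBD b e) * (1 - xCD c e)
          + xAC a c * xCD c e * (1 - xAB a b) * (1 - xAD a e) * (1 - xBC b c) * (1 - xBD b e)
          + xAD a e * xBD b e * (1 - xAB a b) * (1 - xAC a c) * (1 - xBC b c) * (1 - xCD c e)
          + xAD a e * xCD c e * (1 - xAB a b) * (1 - xAC a c) * (1 - xBC b c) * (1 - xBD b e)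
          + xBC b c * xBD b e * (1 - xAB a b) * (1 - xAC a c) * (1 - xAD a e) * (1 - xCD c e)
          + xBC b c * xCD c e * (1 - xAB a b) * (1 - xAC a c) * (1 - xAD a e) * (1 - xBD b e)
          + xBD b e * xCD c e * (1 - xAB a b) * (1 - xAC a c) * (1 - xAD a e) * (1 - xBC b c))
      + 4 * (xAB a b * xAC a c * xAD a e * xBC b c * xBD b e * (1 - xCD c e)
          + xAB a b * xAC a c * xAD a e * xBC b c * xCD c e * (1 - xBD b e)
          + xAB a b * xAC a c * xAD a e * xBD b e * xCD c e * (1 - xBC b c)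
          + xAB a b * xAC a c * xBC b c * xBD b e * xCD c e * (1 - xAD a e)
          + xAB a b * xAD a e * xBC b c * xBD b e * xCD c e * (1 - xAC a c)
          + xAC a c * xAD a e * xBC b c * xBD b e * xCD c e * (1 - xAB a b))
      - 2 * (xAB a b * xCD c e * (1 - xAC a c) * (1 - xAD a e) * (1 - xBC b c) * (1 - xBD b e)
          + xAC a c * xBD b e * (1 - xAB a b) * (1 - xAD a e) * (1 - xBC b c) * (1 - xCD c e)
          + xAD a e * xBC b c * (1 - xAB a b) * (1 - xAC a c) * (1 - xBD b e) * (1 - xCD c e)))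
      = ((tB + tC + tD) * (∑ a, μA a * μA a) + (tA + tC + tD) * (∑ b, μB b * μB b)
          + (tA + tB + tD) * (∑ c, μC c * μC c) + (tA + tB + tC) * (∑ e, μD e * μD e))
        - 6 * m ^ 2
        - 3 * (tD * (∑ a, ∑ b, ∑ c, xAB a b * xAC a c * xBC b c)
          + tC * (∑ a, ∑ b, ∑ e, xAB a b * xAD a e * xBD b e)
          + tB * (∑ a, ∑ c, ∑ e, xAC a c * xAD a e * xCD c e)
          + tA * (∑ b, ∑ c, ∑ e, xBC b c * xBD b e * xCD c e))
        - 3 * ((∑ a, μA a * μA a * μA a) + (∑ b, μB b * μB b * μB b)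
          + (∑ c, μC c * μC c * μC c) + (∑ e, μD e * μD e * μD e))
        + 3 * ((∑ a, (∑ b, ∑ c, xAB a b * xAC a c * xBC b c) * μA a)
          + (∑ a, ∑ b, (∑ c, xAB a b * xAC a c * xBC b c) * μB b)
          + (∑ a, ∑ b, ∑ c, xAB a b * xAC a c * xBC b c * μC c)
          + (∑ a, (∑ b, ∑ e, xAB a b * xAD a e * xBD b e) * μA a)
          + (∑ a, ∑ b, (∑ e, xAB a b * xAD a e * xBD b e) * μB b)
          + (∑ a, ∑ b, ∑ e, xAB a b * xAD a e * xBD b e * μD e)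
          + (∑ a, (∑ c, ∑ e, xAC a c * xAD a e * xCD c e) * μA a)
          + (∑ a, ∑ c, (∑ e, xAC a c * xAD a e * xCD c e) * μC c)
          + (∑ a, ∑ c, ∑ e, xAC a c * xAD a e * xCD c e * μD e)
          + (∑ b, (∑ c, ∑ e, xBC b c * xBD b e * xCD c e) * μB b)
          + (∑ b, ∑ c, (∑ e, xBC b c * xBD b e * xCD c e) * μC c)
          + (∑ b, ∑ c, ∑ e, xBC b c * xBD b e * xCD c e * μD e)) := by
  -- Fubini, local (leaves-first orders): swap12, out3, out4, swap34, in2, in1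
  have sum4_swap12 : ∀ f : A → B → C → D → R,
      ∑ a, ∑ b, ∑ c, ∑ e, f a b c e = ∑ b, ∑ a, ∑ c, ∑ e, f a b c e := fun f => Finset.sum_comm
  have sum4_out3 : ∀ f : A → B → C → D → R,
      ∑ a, ∑ b, ∑ c, ∑ e, f a b c e = ∑ c, ∑ a, ∑ b, ∑ e, f a b c e :=
    fun f => (Finset.sum_congr rfl fun _ _ => Finset.sum_comm).trans Finset.sum_comm
  have sum4_out4 : ∀ f : A → B → C → D → R,
      ∑ a, ∑ b, ∑ c, ∑ e, f a b c e = ∑ e, ∑ a, ∑ b, ∑ c, f a b c e :=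
    fun f => (Finset.sum_congr rfl fun _ _ =>
      (Finset.sum_congr rfl fun _ _ => Finset.sum_comm).trans Finset.sum_comm).trans Finset.sum_comm
  have sum4_swap34 : ∀ f : A → B → C → D → R,
      ∑ a, ∑ b, ∑ c, ∑ e, f a b c e = ∑ a, ∑ b, ∑ e, ∑ c, f a b c e :=
    fun f => Finset.sum_congr rfl fun _ _ => Finset.sum_congr rfl fun _ _ => Finset.sum_comm
  have sum4_in2 : ∀ f : A → B → C → D → R,
      ∑ a, ∑ b, ∑ c, ∑ e, f a b c e = ∑ a, ∑ c, ∑ e, ∑ b, f a b c e :=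
    fun f => Finset.sum_congr rfl fun _ _ =>
      Finset.sum_comm.trans (Finset.sum_congr rfl fun _ _ => Finset.sum_comm)
  have sum4_in1 : ∀ f : A → B → C → D → R,
      ∑ a, ∑ b, ∑ c, ∑ e, f a b c e = ∑ b, ∑ c, ∑ e, ∑ a, f a b c e :=
    fun f => Finset.sum_comm.trans (Finset.sum_congr rfl fun _ _ =>
      Finset.sum_comm.trans (Finset.sum_congr rfl fun _ _ => Finset.sum_comm))
  -- the pointwise expansion (the coefficient table of `FlatMomentIdentity.momentM_monomials`)
  have hpt : ∀ x1 x2 x3 x4 x5 x6 : R,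
      18 * (x1 * x2 * x3 * x4 * x5 * x6)
      + (x1 * x2 * (1 - x3) * (1 - x4) * (1 - x5) * (1 - x6)
        + x1 * x3 * (1 - x2) * (1 - x4) * (1 - x5) * (1 - x6)
        + x1 * x4 * (1 - x2) * (1 - x3) * (1 - x5) * (1 - x6)
        + x1 * x5 * (1 - x2) * (1 - x3) * (1 - x4) * (1 - x6)
        + x2 * x3 * (1 - x1) * (1 - x4) * (1 - x5) * (1 - x6)
        + x2 * x4 * (1 - x1) * (1 - x3) * (1 - x5) * (1 - x6)
        + x2 * x6 * (1 - x1) * (1 - x3) * (1 - x4) * (1 - x5)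
        + x3 * x5 * (1 - x1) * (1 - x2) * (1 - x4) * (1 - x6)
        + x3 * x6 * (1 - x1) * (1 - x2) * (1 - x4) * (1 - x5)
        + x4 * x5 * (1 - x1) * (1 - x2) * (1 - x3) * (1 - x6)
        + x4 * x6 * (1 - x1) * (1 - x2) * (1 - x3) * (1 - x5)
        + x5 * x6 * (1 - x1) * (1 - x2) * (1 - x3) * (1 - x4))
      + 4 * (x1 * x2 * x3 * x4 * x5 * (1 - x6) + x1 * x2 * x3 * x4 * x6 * (1 - x5)
        + x1 * x2 * x3 * x5 * x6 * (1 - x4) + x1 * x2 * x4 * x5 * x6 * (1 - x3)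
        + x1 * x3 * x4 * x5 * x6 * (1 - x2) + x2 * x3 * x4 * x5 * x6 * (1 - x1))
      - 2 * (x1 * x6 * (1 - x2) * (1 - x3) * (1 - x4) * (1 - x5)
        + x2 * x5 * (1 - x1) * (1 - x3) * (1 - x4) * (1 - x6)
        + x3 * x4 * (1 - x1) * (1 - x2) * (1 - x5) * (1 - x6))
      = (x1 * x2 + x1 * x3 + x2 * x3 + x1 * x4 + x1 * x5 + x4 * x5
          + x2 * x4 + x2 * x6 + x4 * x6 + x3 * x5 + x3 * x6 + x5 * x6)
        - 2 • (x1 * x6 + x2 * x5 + x3 * x4)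
        - 3 • (x1 * x2 * x4 + x1 * x3 * x5 + x2 * x3 * x6 + x4 * x5 * x6)
        - 3 • (x1 * x2 * x3 + x1 * x4 * x5 + x2 * x4 * x6 + x3 * x5 * x6)
        + 3 • (x1 * x2 * x4 * x3 + x1 * x2 * x4 * x5 + x1 * x2 * x4 * x6
          + x1 * x3 * x5 * x2 + x1 * x3 * x5 * x4 + x1 * x3 * x5 * x6
          + x2 * x3 * x6 * x1 + x2 * x3 * x6 * x4 + x2 * x3 * x6 * x5
          + x4 * x5 * x6 * x1 + x4 * x5 * x6 * x2 + x4 * x5 * x6 * x3) := by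
    intros; simp only [nsmul_eq_mul, Nat.cast_ofNat]; ring
  simp_rw [hpt]
  simp only [sum_add_distrib, sum_sub_distrib, ← smul_sum]
  -- leaves first: the centre of a 2-path ∕ star is summed last, a pendant leaf first
  rw [sum4_swap12 fun a b c _ => xAB a b * xBC b c, sum4_swap12 fun a b _ e => xAB a b * xBD b e,
    sum4_out3 fun a b c _ => xAC a c * xBC b c, sum4_out3 fun a _ c e => xAC a c * xCD c e,
    sum4_out3 fun _ b c e => xBC b c * xCD c e,
    sum4_out4 fun a b _ e => xAD a e * xBD b e, sum4_out4 fun a _ c e => xAD a e * xCD c e,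
    sum4_out4 fun _ b c e => xBD b e * xCD c e,
    sum4_swap12 fun a b c e => xAB a b * xBC b c * xBD b e,
    sum4_out3 fun a b c e => xAC a c * xBC b c * xCD c e,
    sum4_out4 fun a b c e => xAD a e * xBD b e * xCD c e,
    sum4_swap34 fun a b c e => xAB a b * xAD a e * xBD b e * xCD c e,
    sum4_in2 fun a b c e => xAC a c * xAD a e * xCD c e * xBC b c,
    sum4_in2 fun a b c e => xAC a c * xAD a e * xCD c e * xBD b e,
    sum4_in1 fun a b c e => xBC b c * xBD b e * xCD c e * xAB a b,
    sum4_in1 fun a b c e => xBC b c * xBD b e * xCD c e * xAC a c,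
    sum4_in1 fun a b c e => xBC b c * xBD b e * xCD c e * xAD a e]
  simp only [sum_const, card_univ, nsmul_eq_mul, hA, hB, hC, hD, ← mul_sum, ← sum_mul,
    rAB, cAB, rAC, cAC, rAD, cAD, rBC, cBC, rBD, cBD, rCD, cCD, hmA, hmB, hmC, Nat.cast_ofNat]
  ring

end UniformMarginMomentIdentity
end Summit.Ventures.HSemireg
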